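import Summits.HodgeConjecture.HodgeConjecture.Theorems.Ring2WeilCoverageCMFieldNormResidueSymbolsLocal
import Literature.NumberTheory.QuadraticForms.HilbertReciprocityFiniteness
import HarnessLib

/-!
# Ring 2 — Weil-family coverage, CM-field rows: the local symbol `(q, θ)_v` at the DYADIC places (and at every place
  after a square-class change of the radicand `θ = c²b`) — sub-cell (ix″) of the closed form of the row index `δ`
  (WEIL-FAMILY-COVERAGE «## b03», part 6)

research route conditional on HC_CM; not a corollary; Q11.4-sentence-2 already refuted in dim ≥ 3.

Sequel of `Ring2WeilCoverageCMFieldNormResidueSymbolsLocal` (`v ∤ 2θ`) and `…Ramified` (`v ∤ 2`, `θ` a uniformiser).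
The rows `W_{2k}.E.δ` of the census over Deligne's carrier `R` (`F = ℚ[S]/(R) = ℚ(θ)`, `E = F(√θ)`,
`δ ∈ F^×/Nm_{E/F}(E^×) = cmNormResidueGroup R`) are labelled by `T(q) = badPlaces q θ`, the finite even set of places of `F`
at which `(q, θ)_𝔭 = -1` [cite: Deligne1982HodgeCycles, §4: display (1), Prop. 4.1, Cor. 4.2]; parts 1–5 gave the closed
form of the membership of every place EXCEPT the dyadic ones (and the non-dyadic ones with `ord_v θ ≥ 2`).  This file:

* §10 `placeSymbol_root_eq_of_eq_sq_mul` / `badPlaces_root_eq_of_eq_sq_mul`: the labels only depend on the SQUARE CLASS of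
  the radicand — if `θ = c² b` in `F` then `(q, θ)_𝔭 = (q, b)_𝔭` at every place and `T(q) = badPlaces q b`; so at a
  non-dyadic place where `b ∈ 𝓞_F` is a unit resp. a uniformiser the closed forms of parts 3 and 5 hold with `b` for `θ`
  (`…_of_eq_sq_mul_of_notMem`, `…_of_eq_sq_mul_of_uniformizer`) — the places with `ord_v θ` even resp. odd `≥ 3`.
* §11 THE DYADIC PLACES under a dyadic normalisation `θ = c²(1 + 4ρ)`, `ρ ∈ 𝓞_F` (which exists iff `E/F` is unramified
  above `2`; e.g. `ℚ(ζ₅)`: `θ = (θ+3)²(1 + 4(θ+1))`; `ℚ(ζ₁₂)`, `ℚ(√-3,√5)`: `1 + 4ρ = -3`): by the tree's O'Meara 63:16 for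
  the Artin–Schreier presentation `F_v(√(1+4ρ)) = F_v(℘⁻¹ρ)` (`hilbertSymbol_one_add_four_mul_eq_neg_one_iff`,
  `isSquare_one_add_four_mul_adicCompletion_iff`) [cite: Omeara1963, §63C Example 63:16]:
  **`v ∈ T(q) ⟺ (X² - X - ρ has no root mod v) ∧ ord_v q odd`** at every `v ∣ 2` — INERT dyadic places enter by
  valuation parity, SPLIT dyadic places never; the parity of `ord_v q` at an inert dyadic place is a class invariant and
  `[q] ≠ [(-1)^k]` when it is odd.
* §12 THE PARITY COMPLEMENT (no normalisation, every carrier): `|T(q)|` is even (Hilbert reciprocity 71:18, part 2), so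
  **`𝔭₀ ∈ T(q) ⟺ |T(q) ∖ {𝔭₀}|` is odd** — at a carrier whose real field has ONE dyadic place (all seven quartic census
  fields: `F = ℚ(√2), ℚ(√3), ℚ(√5)`) the dyadic membership is DETERMINED by the non-dyadic and infinite ones, which parts
  2–5 give in closed form; this covers the dyadic-RAMIFIED carriers (`ℚ(ζ₈)`, `ℚ(i,√5)`, `ℚ(√-(2+√2))`, `ℚ(√-(3+√2))`)
  where no dyadic normalisation exists. [cite: Omeara1963, §71D Thm. 71:18]
No new definition, no named fact, no sorry; nothing about the Hodge conjecture is asserted.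
-/

noncomputable section

set_option linter.dupNamespace false

open Polynomial NumberField IsDedekindDomain

namespace Summit.HodgeConjecture.HodgeConjecture.Ring2.WeilCoverageCM

open Literature.AlgebraicGeometry.Deligne1982
open Literature.AlgebraicGeometry.HodgeTheory (splitDiscriminantClassCM)
open Literature.NumberTheory.QuadraticForms

variable {R : Polynomial ℤ} [Fact (Irreducible (cmPolyQ R))] [Fact (Irreducible (realPolyQ R))]

/-! ### §10 The labels only depend on the square class of the radicand: `θ = c² b` -/

/-- If `θ = c² b` in `F` then `c ≠ 0` (`θ ≠ 0`). [folklore] -/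
theorem ne_zero_of_root_eq_sq_mul {c b : realField R} (hfac : AdjoinRoot.root (realPolyQ R) = c ^ 2 * b) : c ≠ 0 := by
  rintro rfl
  exact root_realPolyQ_ne_zero (R := R) (by rw [hfac]; ring)

/-- If `θ = c² b` in `F` then `b ≠ 0`. [folklore] -/
theorem right_ne_zero_of_root_eq_sq_mul {c b : realField R} (hfac : AdjoinRoot.root (realPolyQ R) = c ^ 2 * b) : b ≠ 0 := by
  rintro rfl
  exact root_realPolyQ_ne_zero (R := R) (by rw [hfac]; ring)

/-- **Square-class change of the radicand, at every place**: if `θ = c² b` in `F` then `(t, θ)_𝔭 = (t, b)_𝔭` for every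
place `𝔭` of `F`, finite or infinite (the Hilbert symbol only depends on square classes, O'Meara §63B).
[cite: Omeara1963, §63B (formulas after 63:10)] -/
theorem placeSymbol_root_eq_of_eq_sq_mul {c b : realField R} (hfac : AdjoinRoot.root (realPolyQ R) = c ^ 2 * b)
    (t : realField R) (p : HeightOneSpectrum (𝓞 (realField R)) ⊕ InfinitePlace (realField R)) :
    placeSymbol t (AdjoinRoot.root (realPolyQ R)) p = placeSymbol t b p := by
  have hc := ne_zero_of_root_eq_sq_mul hfac
  cases p with
  | inl v =>
    rw [placeSymbol_inl, placeSymbol_inl, hfac, map_mul, map_pow, mul_comm,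
      hilbertSymbol_mul_sq_right _ _ ((_root_.map_ne_zero _).2 hc)]
  | inr w =>
    rw [placeSymbol_inr, placeSymbol_inr, hfac, map_mul, map_pow, mul_comm,
      hilbertSymbol_mul_sq_right _ _ ((_root_.map_ne_zero _).2 hc)]

/-- Hence **`T(t) = badPlaces t b`** whenever `θ = c² b`: the census labels may be computed against ANY representative of
the square class of `θ` in `F^×`. [cite: Omeara1963, §63B (formulas after 63:10)] [cite: Deligne1982HodgeCycles, §4 (1)] -/
theorem badPlaces_root_eq_of_eq_sq_mul {c b : realField R} (hfac : AdjoinRoot.root (realPolyQ R) = c ^ 2 * b)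
    (t : realField R) : badPlaces t (AdjoinRoot.root (realPolyQ R)) = badPlaces t b := by
  ext p
  rw [mem_badPlaces_iff, mem_badPlaces_iff, placeSymbol_root_eq_of_eq_sq_mul hfac]

/-- The finite-place symbol after a square-class change to an INTEGRAL representative `b ∈ 𝓞_F`:
`(t, θ)_v = (t, b)_v` with `b` read in `𝓞_F → F_v`. [cite: Omeara1963, §63B (formulas after 63:10)] -/
theorem hilbertSymbol_adicCompletion_root_eq_of_eq_sq_mul {c : realField R} {b : 𝓞 (realField R)}
    (hfac : AdjoinRoot.root (realPolyQ R) = c ^ 2 * (b : realField R)) (v : HeightOneSpectrum (𝓞 (realField R)))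
    (t : realField R) :
    hilbertSymbol (v.adicCompletion (realField R)) (algebraMap (realField R) _ t)
        (algebraMap (realField R) _ (AdjoinRoot.root (realPolyQ R))) =
      hilbertSymbol (v.adicCompletion (realField R)) (algebraMap (realField R) _ t)
        (algebraMap (𝓞 (realField R)) _ b) := by
  have h := placeSymbol_root_eq_of_eq_sq_mul hfac t (Sum.inl v)
  rw [placeSymbol_inl, placeSymbol_inl] at h
  rw [h, IsScalarTower.algebraMap_apply (𝓞 (realField R)) (realField R) (v.adicCompletion (realField R))]

/-- **Non-dyadic place, `θ = c² b` with `b` a `v`-UNIT** (the places with `ord_v θ` EVEN): `(t, θ)_v = -1 ⟺ b` is a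
non-square mod `v ∧ ord_v t` odd (O'Meara 63:11a/63:12 for `b`). [cite: Omeara1963, §63B Cor. 63:11a and Example 63:12] -/
theorem hilbertSymbol_adicCompletion_root_eq_neg_one_iff_of_eq_sq_mul_of_notMem {c : realField R}
    {b : 𝓞 (realField R)} (hfac : AdjoinRoot.root (realPolyQ R) = c ^ 2 * (b : realField R))
    (v : HeightOneSpectrum (𝓞 (realField R))) (h2 : (2 : 𝓞 (realField R)) ∉ v.asIdeal) (hbv : b ∉ v.asIdeal)
    {t : realField R} (ht : t ≠ 0) :
    hilbertSymbol (v.adicCompletion (realField R)) (algebraMap (realField R) _ t)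
        (algebraMap (realField R) _ (AdjoinRoot.root (realPolyQ R))) = -1 ↔
      ¬ IsSquare (Ideal.Quotient.mk v.asIdeal b) ∧ Odd (WithZero.log (v.valuation (realField R) t)) := by
  rw [hilbertSymbol_adicCompletion_root_eq_of_eq_sq_mul hfac,
    hilbertSymbol_eq_neg_one_iff_not_isSquare_and_odd (realField R) v h2 hbv ((_root_.map_ne_zero _).2 ht)]
  have e1 : IsSquare (algebraMap (𝓞 (realField R)) (v.adicCompletion (realField R)) b) ↔
      IsSquare (Ideal.Quotient.mk v.asIdeal b) :=
    isSquare_algebraMap_adicCompletion_iff (realField R) v h2 hbv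
  have e2 : Valued.v (algebraMap (realField R) (v.adicCompletion (realField R)) t) =
      v.valuation (realField R) t :=
    HeightOneSpectrum.valuedAdicCompletion_eq_valuation' v t
  rw [e2]
  exact and_congr (not_congr e1) Iff.rfl

/-- **Non-dyadic place, `θ = c² b` with `b` a UNIFORMISER at `v`** (the places with `ord_v θ` ODD, any size): for a
`v`-unit `u ∈ 𝓞_F`, `(u, θ)_v = -1 ⟺ u` is a non-square mod `v` (O'Meara 63:12 for `b`).
[cite: Omeara1963, §63 Example 63:12] -/
theorem hilbertSymbol_adicCompletion_unit_root_eq_neg_one_iff_of_eq_sq_mul_of_uniformizer {c : realField R}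
    {b : 𝓞 (realField R)} (hfac : AdjoinRoot.root (realPolyQ R) = c ^ 2 * (b : realField R))
    (v : HeightOneSpectrum (𝓞 (realField R))) (h2 : (2 : 𝓞 (realField R)) ∉ v.asIdeal)
    (hb1 : v.intValuation b = WithZero.exp (-1 : ℤ)) {u : 𝓞 (realField R)} (hu : u ∉ v.asIdeal) :
    hilbertSymbol (v.adicCompletion (realField R)) (algebraMap (realField R) _ (u : realField R))
        (algebraMap (realField R) _ (AdjoinRoot.root (realPolyQ R))) = -1 ↔
      ¬ IsSquare (Ideal.Quotient.mk v.asIdeal u) := by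
  have h1 : (1 : 𝓞 (realField R)) ∉ v.asIdeal := fun h ↦ v.isPrime.ne_top ((Ideal.eq_top_iff_one _).2 h)
  have hu' : algebraMap (realField R) (v.adicCompletion (realField R)) (u : realField R) =
      algebraMap (𝓞 (realField R)) (v.adicCompletion (realField R)) u :=
    (IsScalarTower.algebraMap_apply (𝓞 (realField R)) (realField R) (v.adicCompletion (realField R)) u).symm
  rw [hilbertSymbol_adicCompletion_root_eq_of_eq_sq_mul hfac, hu', hilbertSymbol_comm, ← hilbertSymbol_ne_one_iff, Ne,
    show (b : 𝓞 (realField R)) = b * 1 from (mul_one b).symm]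
  exact not_congr (hilbertSymbol_uniformizer_mul_iff (realField R) v h2 hb1 h1 hu)

/-! ### §11 The dyadic places under a dyadic normalisation `θ = c² (1 + 4ρ)` (O'Meara 63:16) -/

/-- **CLOSED FORM at every finite place where `1 + 4ρ` is a unit** (all dyadic ones, and the non-dyadic `v ∤ 1 + 4ρ`), for a
carrier with a dyadic normalisation `θ = c²(1 + 4ρ)`, `ρ ∈ 𝓞_F`: `(t, θ)_v = -1 ⟺ 1 + 4ρ ∉ F_v² ∧ ord_v t` odd — the
extension `F_v(√θ) = F_v(√(1+4ρ))` is unramified, inert iff `1 + 4ρ` is a local non-square (O'Meara Example 63:16).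
[cite: Omeara1963, §63C Example 63:16] -/
theorem hilbertSymbol_adicCompletion_root_eq_neg_one_iff_of_normalisation {c : realField R} {ρ : 𝓞 (realField R)}
    (hfac : AdjoinRoot.root (realPolyQ R) = c ^ 2 * ((1 + 4 * ρ : 𝓞 (realField R)) : realField R))
    (v : HeightOneSpectrum (𝓞 (realField R))) (hθv : (1 + 4 * ρ : 𝓞 (realField R)) ∉ v.asIdeal)
    {t : realField R} (ht : t ≠ 0) :
    hilbertSymbol (v.adicCompletion (realField R)) (algebraMap (realField R) _ t)
        (algebraMap (realField R) _ (AdjoinRoot.root (realPolyQ R))) = -1 ↔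
      ¬ IsSquare (algebraMap (𝓞 (realField R)) (v.adicCompletion (realField R)) (1 + 4 * ρ)) ∧
        Odd (WithZero.log (v.valuation (realField R) t)) := by
  rw [hilbertSymbol_adicCompletion_root_eq_of_eq_sq_mul hfac,
    hilbertSymbol_one_add_four_mul_eq_neg_one_iff (realField R) v ρ hθv ((_root_.map_ne_zero _).2 ht)]
  have e2 : Valued.v (algebraMap (realField R) (v.adicCompletion (realField R)) t) =
      v.valuation (realField R) t :=
    HeightOneSpectrum.valuedAdicCompletion_eq_valuation' v t
  rw [e2]

/-- **THE DYADIC SYMBOL**: at a place `v ∣ 2` of `F`, for a carrier with `θ = c²(1 + 4ρ)`: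
`(t, θ)_v = -1 ⟺ (X² - X - ρ has NO root modulo v) ∧ ord_v t` odd (Hensel for the Artin–Schreier equation decides
`1 + 4ρ ∈ F_v²`). [cite: Omeara1963, §63C Example 63:16] [cite: Omeara1963, §63A (quadratic defect of `1 + 4ρ`)] -/
theorem hilbertSymbol_adicCompletion_root_eq_neg_one_iff_of_dyadic {c : realField R} {ρ : 𝓞 (realField R)}
    (hfac : AdjoinRoot.root (realPolyQ R) = c ^ 2 * ((1 + 4 * ρ : 𝓞 (realField R)) : realField R))
    (v : HeightOneSpectrum (𝓞 (realField R))) (h2 : (2 : 𝓞 (realField R)) ∈ v.asIdeal)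
    {t : realField R} (ht : t ≠ 0) :
    hilbertSymbol (v.adicCompletion (realField R)) (algebraMap (realField R) _ t)
        (algebraMap (realField R) _ (AdjoinRoot.root (realPolyQ R))) = -1 ↔
      (∀ r : 𝓞 (realField R), r ^ 2 - r - ρ ∉ v.asIdeal) ∧ Odd (WithZero.log (v.valuation (realField R) t)) := by
  rw [hilbertSymbol_adicCompletion_root_eq_neg_one_iff_of_normalisation hfac v (one_add_four_mul_notMem (realField R) v h2 ρ)
      ht, isSquare_one_add_four_mul_adicCompletion_iff (realField R) v h2 ρ, not_exists]

/-- **Membership of a dyadic place in `T(q)`**: `v ∈ T(q) ⟺ (X² - X - ρ irreducible mod v) ∧ ord_v q odd`.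
[cite: Omeara1963, §63C Example 63:16] [cite: Deligne1982HodgeCycles, §4 (1)] -/
theorem inl_mem_badPlaces_iff_of_dyadic {c : realField R} {ρ : 𝓞 (realField R)}
    (hfac : AdjoinRoot.root (realPolyQ R) = c ^ 2 * ((1 + 4 * ρ : 𝓞 (realField R)) : realField R))
    (v : HeightOneSpectrum (𝓞 (realField R))) (h2 : (2 : 𝓞 (realField R)) ∈ v.asIdeal) (q : (realField R)ˣ) :
    Sum.inl v ∈ badPlaces (q : realField R) (AdjoinRoot.root (realPolyQ R)) ↔
      (∀ r : 𝓞 (realField R), r ^ 2 - r - ρ ∉ v.asIdeal) ∧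
        Odd (WithZero.log (v.valuation (realField R) (q : realField R))) := by
  rw [mem_badPlaces_iff, placeSymbol_inl, hilbertSymbol_adicCompletion_root_eq_neg_one_iff_of_dyadic hfac v h2 (Units.ne_zero _)]

/-- **INERT dyadic place** (`X² - X - ρ` has no root mod `v`): `v ∈ T(q) ⟺ ord_v q` odd — valuation parity, exactly as
at the inert places `v ∤ 2θ` of part 3. [cite: Omeara1963, §63C Example 63:16] [cite: Deligne1982HodgeCycles, §4 (1)] -/
theorem inl_mem_badPlaces_iff_odd_of_dyadic_inert {c : realField R} {ρ : 𝓞 (realField R)}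
    (hfac : AdjoinRoot.root (realPolyQ R) = c ^ 2 * ((1 + 4 * ρ : 𝓞 (realField R)) : realField R))
    (v : HeightOneSpectrum (𝓞 (realField R))) (h2 : (2 : 𝓞 (realField R)) ∈ v.asIdeal)
    (hinert : ∀ r : 𝓞 (realField R), r ^ 2 - r - ρ ∉ v.asIdeal) (q : (realField R)ˣ) :
    Sum.inl v ∈ badPlaces (q : realField R) (AdjoinRoot.root (realPolyQ R)) ↔
      Odd (WithZero.log (v.valuation (realField R) (q : realField R))) := by
  rw [inl_mem_badPlaces_iff_of_dyadic hfac v h2]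
  exact ⟨fun h ↦ h.2, fun h ↦ ⟨hinert, h⟩⟩

/-- **SPLIT dyadic place** (`X² - X - ρ` has a root mod `v`): `v ∉ T(q)` for every `q` — a dyadic place of `F` split in
`E` lies in no `T(δ)`. [cite: Omeara1963, §63C Example 63:16] [cite: Deligne1982HodgeCycles, §4 (1)] -/
theorem inl_notMem_badPlaces_of_dyadic_split {c : realField R} {ρ : 𝓞 (realField R)}
    (hfac : AdjoinRoot.root (realPolyQ R) = c ^ 2 * ((1 + 4 * ρ : 𝓞 (realField R)) : realField R))
    (v : HeightOneSpectrum (𝓞 (realField R))) (h2 : (2 : 𝓞 (realField R)) ∈ v.asIdeal)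
    (hsplit : ∃ r : 𝓞 (realField R), r ^ 2 - r - ρ ∈ v.asIdeal) (q : (realField R)ˣ) :
    Sum.inl v ∉ badPlaces (q : realField R) (AdjoinRoot.root (realPolyQ R)) := by
  rw [inl_mem_badPlaces_iff_of_dyadic hfac v h2, not_and_or, not_forall]
  obtain ⟨r, hr⟩ := hsplit
  exact Or.inl ⟨r, not_not.2 hr⟩

/-- **The parity of `ord_v` at an inert dyadic place is a CLASS INVARIANT** of `[q] ∈ F^×/Nm_{E/F}(E^×)`.
[cite: Deligne1982HodgeCycles, §4 (1) and Prop. 4.1] [cite: Omeara1963, §63C Example 63:16] -/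
theorem odd_log_valuation_iff_of_mk_eq_mk_dyadic {c : realField R} {ρ : 𝓞 (realField R)}
    (hfac : AdjoinRoot.root (realPolyQ R) = c ^ 2 * ((1 + 4 * ρ : 𝓞 (realField R)) : realField R))
    (v : HeightOneSpectrum (𝓞 (realField R))) (h2 : (2 : 𝓞 (realField R)) ∈ v.asIdeal)
    (hinert : ∀ r : 𝓞 (realField R), r ^ 2 - r - ρ ∉ v.asIdeal) {q q' : (realField R)ˣ}
    (h : (QuotientGroup.mk q : cmNormResidueGroup R) = QuotientGroup.mk q') :
    Odd (WithZero.log (v.valuation (realField R) (q : realField R))) ↔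
      Odd (WithZero.log (v.valuation (realField R) (q' : realField R))) := by
  rw [← inl_mem_badPlaces_iff_odd_of_dyadic_inert hfac v h2 hinert,
    ← inl_mem_badPlaces_iff_odd_of_dyadic_inert hfac v h2 hinert, (mk_eq_mk_iff_badPlaces_eq q q').1 h]

/-- **Distinct rows by dyadic valuation parity**: `ord_v q` odd and `ord_v q'` even at an inert dyadic place give
`[q] ≠ [q']`. [cite: Deligne1982HodgeCycles, §4 (1) and Prop. 4.1] [cite: Omeara1963, §63C Example 63:16] -/
theorem mk_ne_mk_of_odd_log_valuation_dyadic {c : realField R} {ρ : 𝓞 (realField R)}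
    (hfac : AdjoinRoot.root (realPolyQ R) = c ^ 2 * ((1 + 4 * ρ : 𝓞 (realField R)) : realField R))
    (v : HeightOneSpectrum (𝓞 (realField R))) (h2 : (2 : 𝓞 (realField R)) ∈ v.asIdeal)
    (hinert : ∀ r : 𝓞 (realField R), r ^ 2 - r - ρ ∉ v.asIdeal) {q q' : (realField R)ˣ}
    (hq : Odd (WithZero.log (v.valuation (realField R) (q : realField R))))
    (hq' : ¬ Odd (WithZero.log (v.valuation (realField R) (q' : realField R)))) :
    (QuotientGroup.mk q : cmNormResidueGroup R) ≠ QuotientGroup.mk q' := fun h ↦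
  hq' ((odd_log_valuation_iff_of_mk_eq_mk_dyadic hfac v h2 hinert h).1 hq)

/-- **NON-SPLIT by dyadic valuation parity**: a class `[q]` with `ord_v q` ODD at an inert dyadic place `v` of `F` is not
the split class `[(-1)^k]` of any `E`-rank `2k` (Deligne Cor. 4.2: no `E`-Lagrangian member on `W_{2k}.E.[q]`) — the
«dyadic rows» (`[2]` of `ℚ(ζ₅)`, `ℚ(ζ₉)`, …) uniformly. [cite: Deligne1982HodgeCycles, §4 (1) and Cor. 4.2]
[cite: Omeara1963, §63C Example 63:16] -/
theorem mk_ne_splitDiscriminantClassCM_of_odd_log_valuation_dyadic {c : realField R} {ρ : 𝓞 (realField R)}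
    (hfac : AdjoinRoot.root (realPolyQ R) = c ^ 2 * ((1 + 4 * ρ : 𝓞 (realField R)) : realField R))
    (v : HeightOneSpectrum (𝓞 (realField R))) (h2 : (2 : 𝓞 (realField R)) ∈ v.asIdeal)
    (hinert : ∀ r : 𝓞 (realField R), r ^ 2 - r - ρ ∉ v.asIdeal) {q : (realField R)ˣ}
    (hq : Odd (WithZero.log (v.valuation (realField R) (q : realField R)))) (k : ℕ) :
    (QuotientGroup.mk q : cmNormResidueGroup R) ≠ splitDiscriminantClassCM R k := by
  rw [splitDiscriminantClassCM]
  refine mk_ne_mk_of_odd_log_valuation_dyadic hfac v h2 hinert hq ?_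
  rw [Units.val_pow_eq_pow_val, Units.val_neg, Units.val_one, map_pow, Valuation.map_neg, map_one, one_pow,
    WithZero.log_one]
  decide

/-- **Non-dyadic places under the normalisation** (`v ∤ 2(1 + 4ρ)`): `(t, θ)_v = -1 ⟺ 1 + 4ρ` is a non-square mod `v`
`∧ ord_v t` odd — the inert/split closed form of part 3 at the places where `θ` itself need not be a unit.
[cite: Omeara1963, §63B Cor. 63:11a and Example 63:12] -/
theorem hilbertSymbol_adicCompletion_root_eq_neg_one_iff_residue_of_normalisation {c : realField R}
    {ρ : 𝓞 (realField R)}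
    (hfac : AdjoinRoot.root (realPolyQ R) = c ^ 2 * ((1 + 4 * ρ : 𝓞 (realField R)) : realField R))
    (v : HeightOneSpectrum (𝓞 (realField R))) (h2 : (2 : 𝓞 (realField R)) ∉ v.asIdeal)
    (hθv : (1 + 4 * ρ : 𝓞 (realField R)) ∉ v.asIdeal) {t : realField R} (ht : t ≠ 0) :
    hilbertSymbol (v.adicCompletion (realField R)) (algebraMap (realField R) _ t)
        (algebraMap (realField R) _ (AdjoinRoot.root (realPolyQ R))) = -1 ↔
      ¬ IsSquare (Ideal.Quotient.mk v.asIdeal (1 + 4 * ρ : 𝓞 (realField R))) ∧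
        Odd (WithZero.log (v.valuation (realField R) t)) :=
  hilbertSymbol_adicCompletion_root_eq_neg_one_iff_of_eq_sq_mul_of_notMem hfac v h2 hθv ht

/-! ### §12 The parity complement: one place of `T(q)` is determined by the others (Hilbert reciprocity 71:18) -/

/-- **`𝔭₀ ∈ T(q) ⟺ |T(q) ∖ {𝔭₀}|` is ODD**, for every place `𝔭₀` of `F` and every `q ∈ F^×` (`|T(q)|` is even by Hilbert's
reciprocity law): the membership of any ONE place — e.g. the unique dyadic place of a real quadratic `F = ℚ(√d)`,
`d ≢ 1 (mod 8)` — is determined by the memberships of all the others. [cite: Omeara1963, §71D Thm. 71:18]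
[cite: Deligne1982HodgeCycles, §4 (1)] -/
theorem mem_badPlaces_iff_odd_ncard_diff_singleton (q : (realField R)ˣ)
    (p₀ : HeightOneSpectrum (𝓞 (realField R)) ⊕ InfinitePlace (realField R)) :
    p₀ ∈ badPlaces (q : realField R) (AdjoinRoot.root (realPolyQ R)) ↔
      Odd (badPlaces (q : realField R) (AdjoinRoot.root (realPolyQ R)) \ {p₀}).ncard := by
  obtain ⟨hfin, heven⟩ := even_ncard_badPlaces (R := R) q
  set T := badPlaces (q : realField R) (AdjoinRoot.root (realPolyQ R)) with hT
  by_cases hp : p₀ ∈ T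
  · have h := Set.ncard_sdiff_singleton_add_one hp hfin
    refine iff_of_true hp ?_
    rw [← h] at heven
    exact Nat.not_even_iff_odd.1 (Nat.even_add_one.1 heven)
  · rw [Set.sdiff_singleton_eq_self hp]
    exact iff_of_false hp (Nat.not_odd_iff_even.2 heven)

/-- The same for TOTALLY POSITIVE `q` (the polarized rows) among the FINITE places only: a finite place `v₀` lies in the
finite `T`-set of `q` iff the number of OTHER finite places in it is odd. [cite: Omeara1963, §71D Thm. 71:18]
[cite: Deligne1982HodgeCycles, §4 (1)] -/
theorem mem_finite_badPlaces_iff_odd_ncard_diff_singleton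
    (hR : ∀ s : ℂ, Polynomial.eval₂ (Int.castRingHom ℂ) s R = 0 → s.im = 0 ∧ s.re < 0)
    {q : (realField R)ˣ} (hq : ∀ φ : realField R →+* ℝ, 0 < φ q) (v₀ : HeightOneSpectrum (𝓞 (realField R))) :
    v₀ ∈ {v : HeightOneSpectrum (𝓞 (realField R)) |
        hilbertSymbol (v.adicCompletion (realField R)) (algebraMap (realField R) _ (q : realField R))
          (algebraMap (realField R) _ (AdjoinRoot.root (realPolyQ R))) = -1} ↔
      Odd ({v : HeightOneSpectrum (𝓞 (realField R)) |
        hilbertSymbol (v.adicCompletion (realField R)) (algebraMap (realField R) _ (q : realField R))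
          (algebraMap (realField R) _ (AdjoinRoot.root (realPolyQ R))) = -1} \ {v₀}).ncard := by
  have heven := even_ncard_finite_badPlaces hR hq
  have hfin : {v : HeightOneSpectrum (𝓞 (realField R)) |
      hilbertSymbol (v.adicCompletion (realField R)) (algebraMap (realField R) _ (q : realField R))
        (algebraMap (realField R) _ (AdjoinRoot.root (realPolyQ R))) = -1}.Finite := by
    rw [← preimage_inl_badPlaces]
    exact (badPlaces_finite (Units.ne_zero _) root_realPolyQ_ne_zero).preimage Sum.inl_injective.injOn
  set T := {v : HeightOneSpectrum (𝓞 (realField R)) |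
      hilbertSymbol (v.adicCompletion (realField R)) (algebraMap (realField R) _ (q : realField R))
        (algebraMap (realField R) _ (AdjoinRoot.root (realPolyQ R))) = -1} with hT
  by_cases hp : v₀ ∈ T
  · have h := Set.ncard_sdiff_singleton_add_one hp hfin
    refine iff_of_true hp ?_
    rw [← h] at heven
    exact Nat.not_even_iff_odd.1 (Nat.even_add_one.1 heven)
  · rw [Set.sdiff_singleton_eq_self hp]
    exact iff_of_false hp (Nat.not_odd_iff_even.2 heven)

/-- **A UNIQUE dyadic place is decided by the non-dyadic and the infinite places**: if `v₂` is the only place of `F` above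
`2`, then `v₂ ∈ T(q)` iff the number of places `𝔭 ≠ v₂` in `T(q)` — all of them non-dyadic finite (parts 3, 5, §10) or
infinite (part 2: the real places where `q < 0`) — is odd. [cite: Omeara1963, §71D Thm. 71:18]
[cite: Deligne1982HodgeCycles, §4 (1)] -/
theorem inl_mem_badPlaces_iff_odd_ncard_of_unique_dyadic (q : (realField R)ˣ)
    (v₂ : HeightOneSpectrum (𝓞 (realField R))) (h2 : (2 : 𝓞 (realField R)) ∈ v₂.asIdeal)
    (huniq : ∀ v : HeightOneSpectrum (𝓞 (realField R)), (2 : 𝓞 (realField R)) ∈ v.asIdeal → v = v₂) :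
    Sum.inl v₂ ∈ badPlaces (q : realField R) (AdjoinRoot.root (realPolyQ R)) ↔
      Odd {p ∈ badPlaces (q : realField R) (AdjoinRoot.root (realPolyQ R)) |
        ∀ v : HeightOneSpectrum (𝓞 (realField R)), p = Sum.inl v → (2 : 𝓞 (realField R)) ∉ v.asIdeal}.ncard := by
  rw [mem_badPlaces_iff_odd_ncard_diff_singleton]
  have hset : badPlaces (q : realField R) (AdjoinRoot.root (realPolyQ R)) \ {Sum.inl v₂} =
      {p ∈ badPlaces (q : realField R) (AdjoinRoot.root (realPolyQ R)) |
        ∀ v : HeightOneSpectrum (𝓞 (realField R)), p = Sum.inl v → (2 : 𝓞 (realField R)) ∉ v.asIdeal} := by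
    ext p
    simp only [Set.mem_sdiff, Set.mem_singleton_iff, Set.mem_setOf_eq]
    exact and_congr_right fun _ ↦
      ⟨fun hne v hpv h2v ↦ hne (by rw [hpv, huniq v h2v]), fun h hpv ↦ h v₂ hpv h2⟩
  rw [hset]

end Summit.HodgeConjecture.HodgeConjecture.Ring2.WeilCoverageCM

end
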